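import Summits.BirchSwinnertonDyer.BirchSwinnertonDyer.Theorems.PrintX10bTwoSidedLinkAnyClassNumberX10bOfPrintFacts
import Summits.BirchSwinnertonDyer.BirchSwinnertonDyer.Theorems.PrintX10bTwoSidedLinkAnyClassNumberX10bCompositeTransfer
import HarnessLib

/-!
# Crux stmt-BirchSwinnertonDyer-23730 `PrintX10b.TwoSidedLinkAnyClassNumberX10b` (B₃) AT EVERY CLASS
# NUMBER: the crux from the four single-source print facts, the transfer `h59g` (Yan–Zhu 2026 Thm. 5.9
# (2) ⟹ (1) at the trivial localisation, read WITHOUT `p ∤ h_K`) and JSW 2017 Thm. 3.3.1 — companion of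
# `…OfPrintFacts.lean` (the class-number-free composite) and of `…CompositeTransfer.lean` (the σ-bridge)

Cell `run/shared/lean/pub/bsd-print-x9/`, seat `bsd-line-x10b-p3` (D-0154 row 10; lead of line
`composite-transfer-x10b` on crux 23730). HONEST FRAMING: theorems only (no definition, no named fact, no
`sorry`); `--supports stmt-BirchSwinnertonDyer-23730`; the crux is NOT closed — every theorem is
CONDITIONAL on the named print facts `h57` (Yan–Zhu Thm. 5.7 (1)), `h422` (BCS Prop. 4.2.2), `h513`
(CGLS Thm. 5.1.3), `hC` (Carayol) / `hpar` (BCDT), the route's by-name `JSWAnticyclotomicControl`, and the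
explicit transfer hypothesis `h59g` (NOT a typed fact; tree-currency caveat in the companion's docstring);
BSD is not proved by any of this and no summit statement is proved by this seat.

* `compositeValuationThree_of_printFacts_of_transfer` — at `p = 3`, BOTH registered stubs of the line
  (`stub_compositeValuationThree_divisibleClassNumber`, `…_coprimeClassNumber`) at once, as the single
  class-number-free hypothesis `hval` of the landed σ-bridge.
* `twoSidedLinkAnyClassNumberX10b_of_printFacts_of_transfer` (+ `_of_modularity`) — **B₃ at every class
  number** modulo `(h57, h59g, h422, h513, hC ∣ hpar, h331)`.
* `imcWaldspurgerOnTreeGoodAt_inducedPlace_of_printFacts_of_transfer` — the general-`p ≥ 3` form: the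
  landed `X11b.imcWaldspurgerOnTreeGoodAt_inducedPlace_of_heegnerContainment_of_thm331` with `hYZ` replaced
  by the five inputs and the binder `¬ p ∣ h_K` deleted (it is the X9 twin B = stmt-23162 letter for letter).

References: [YanZhu2024MainConjNonCM] §5.2, Thm. 5.7 (1), Thm. 5.9; [BurungaleCastellaSkinner2025] Prop.
4.2.2; [CastellaGrossiLeeSkinner2022] Thm. 5.1.3; [JetchevSkinnerWan2017] Thm. 3.3.1, §7.4.1; [Castella2018]
Thm. 2.3, §5 (eq:IMC+BDP); [Carayol1986]; [BCDTJAMS2001] Thm. A.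
-/

-- the summit and its single problem are both named `BirchSwinnertonDyer` (registry layout D-0017)
set_option linter.dupNamespace false
set_option autoImplicit false

noncomputable section

open scoped Classical

open PowerSeries WeierstrassCurve NumberField IsDedekindDomain Field
  Literature.NumberTheory.EllipticCurves Literature.NumberTheory.EllipticCurves.ModularForms
  Literature.NumberTheory.EllipticCurves.Rank1Residual
  Literature.NumberTheory.EllipticCurves.Castella2018
  Literature.NumberTheory.EllipticCurves.YanZhu2026
  Literature.NumberTheory.EllipticCurves.CastellaGrossiLeeSkinner2022
  Literature.NumberTheory.EllipticCurves.JetchevSkinnerWan2017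
  Summit.BirchSwinnertonDyer.Rank1Residual
  Summit.BirchSwinnertonDyer.Rank1Residual.X11b.Halves
  Summit.BirchSwinnertonDyer.Rank1Residual.X1.KellerYinHalves
  Summit.BirchSwinnertonDyer.Rank1Residual.X11b.YZComposite

namespace Summit.BirchSwinnertonDyer.BirchSwinnertonDyer.Cruxes.TwoSidedLinkAnyClassNumberX10b.CompositeTransferX10b

/-! ## §3 B₃ at EVERY class number from the print facts, the transfer, and JSW Thm. 3.3.1 -/

section Crux

/-- **At `p = 3`: BOTH registered stubs of line `composite-transfer-x10b` at once** — the conjunction of the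
bodies of `stub_compositeValuationThree_divisibleClassNumber` (`3 ∣ h_K`) and
`stub_compositeValuationThree_coprimeClassNumber` (`3 ∤ h_K`) is the `p = 3` case of
`compositeValuation_of_printFacts_of_transfer`, the class number never having been used; stated as the
single class-number-free hypothesis `hval` of the landed σ-bridge
`twoSidedLinkAnyClassNumberX10b_of_compositeValuation_of_thm331`.
[cite: YanZhu2024MainConjNonCM, Thm. 5.7 (1) and Thm. 5.9] [cite: BurungaleCastellaSkinner2025, Prop. 4.2.2]
[cite: CastellaGrossiLeeSkinner2022, Thm. 5.1.3] -/
theorem compositeValuationThree_of_printFacts_of_transfer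
    (h57 : thm57_isTorsion_charIdealXGr_eq_bdpLFunction)
    (h59g : ∀ {p : ℕ} [Fact p.Prime] (ι' : PadicAlgCl p ≃+* ℂ) (W : WeierstrassCurve ℚ) [W.IsElliptic]
      [W.IsGloballyMinimal] (K : Type) [Field K] [NumberField K] (v vbar : HeightOneSpectrum (𝓞 K))
      (κ : ZpExtension K p) (γ : absoluteGaloisGroup K) [Fact (κ.IsTopGenerator γ)] {N : ℕ} [NeZero N]
      {f : CuspForm (CongruenceSubgroup.Gamma0 N) 2} (jbar : AlgebraicClosure K →+* ℂ)
      (_ : IsNewformOf W f),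
      N = W.conductorNorm ℤ → 3 ≤ p → GoodOrd W p → (W.baseChange K).HasIrreducibleModPGaloisRep p →
      IsImaginaryQuadratic K → SatisfiesHeegnerHypothesis N K →
        ((Ideal.span {(p : ℤ)}).primesOver (𝓞 K)).ncard = 2 →
        Odd (NumberField.discr K) → NumberField.discr K ≠ -3 → κ.IsAnticyclotomic →
      (∀ (w : InfinitePlace K) (k : 𝓞 K), k ∈ v.asIdeal ↔ ‖ι'.symm (w.embedding (k : K))‖ < 1) →
        ((p : ℕ) : 𝓞 K) ∈ vbar.asIdeal → vbar ≠ v →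
      ∃ (ΩK : ℂ) (Ωp : (unrIntegers p)ˣ) (L : UnrSeries p),
        ΩK ≠ 0 ∧ IsBDPLFunction ι' v κ γ f ΩK ((Ωp : unrIntegers p) : ℂ_[p]) L ∧
        ∀ (D : (W.baseChange K).LambdaAdicSelmerData κ γ) (F : HeegnerFamily N W K κ jbar)
          (X : (W.baseChange K).SelmerDualData κ γ) (j : ℤ_[p] →+* unrIntegers p),
          (∀ x : ℤ_[p], ((j x : unrIntegers p) : ℂ_[p]) = algebraMap ℚ_[p] ℂ_[p] (x : ℚ_[p])) →
          heegnerCharIdeal D F ^ 2 ≤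
              Module.charIdeal (IwasawaAlgebra p) (Submodule.torsion (IwasawaAlgebra p) X.X) →
            L ∈ (AcSelmer.XAc.charIdeal (W.baseChange K) p κ vbar ∅ γ).map (PowerSeries.map j))
    (h422 : BurungaleCastellaSkinner2025.prop422_exists_isBDPLFunction_mu_eq_zero)
    (h513 : thm513_exists_isBDPLFunction_valueAtOne_disc)
    (hC : ∀ (N : ℕ) [NeZero N], IsNewformOf.level_eq_conductorNorm (N := N)) :
    ∀ (W : WeierstrassCurve ℚ) [W.IsElliptic] [W.IsGloballyMinimal] (p : ℕ) [Fact p.Prime],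
      p = 3 → Literature.NumberTheory.EllipticCurves.Rank1Residual.GoodOrd W p →
      ∀ (K : Type) [Field K] [NumberField K], IsImaginaryQuadratic K →
        SatisfiesHeegnerHypothesis (W.conductorNorm ℤ) K → SatisfiesHeegnerHypothesis p K →
        Odd (NumberField.discr K) → NumberField.discr K ≠ -3 →
        (W.baseChange K).HasIrreducibleModPGaloisRep p →
      ∀ (ι : K →+* ℚ_[p]) (v vbar : HeightOneSpectrum (𝓞 K)),
        (∀ x : 𝓞 K, x ∈ v.asIdeal ↔ ‖ι (x : K)‖ < 1) →
        ((p : ℕ) : 𝓞 K) ∈ vbar.asIdeal → vbar ≠ v →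
      ∀ (κ : ZpExtension K p), κ.IsAnticyclotomic →
      ∀ (γ : absoluteGaloisGroup K) [Fact (κ.IsTopGenerator γ)],
      ∀ (N : ℕ) [NeZero N] (Dt : ModularParametrizationData W N)
        (H : HeegnerDatum N (NumberField.discr K)) (ιC : K →+* ℂ) (P : (W.baseChange K).toAffine.Point),
        WeierstrassCurve.Affine.Point.map ιC.toRatAlgHom P = heegnerPointComplex Dt H →
        (∃ (jbar : AlgebraicClosure K →+* ℂ) (D : (W.baseChange K).LambdaAdicSelmerData κ γ)
            (F : HeegnerFamily N W K κ jbar) (X : (W.baseChange K).SelmerDualData κ γ),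
            heegnerCharIdeal D F ^ 2 ≤
              Module.charIdeal (IwasawaAlgebra p) (Submodule.torsion (IwasawaAlgebra p) X.X)) →
      ∀ (G : IwasawaAlgebra p),
        AcSelmer.XAc.charIdeal (W.baseChange K) p κ vbar ∅ γ = Ideal.span {G} →
        PowerSeries.constantCoeff G ≠ 0 →
        ∃ n : ℕ, AcSelmer.XAc.HasCharValuationAt (W.baseChange K) p κ vbar ∅ γ n ∧
          (n : ℤ) = 2 * ((padicValInt p (1 - W.frobeniusTrace p + p) : ℤ) - 1 +
            Literature.NumberTheory.EllipticCurves.padicLogOrd W p ι P) - 2 * (padicValInt p Dt.c : ℤ) := by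
  intro W _ _ p _ hp3 hord
  exact compositeValuation_of_printFacts_of_transfer h57 h59g h422 h513 hC W p (by omega) hord




/-- **B₃ = route item `PrintX10b.TwoSidedLinkAnyClassNumberX10b` (crux stmt-BirchSwinnertonDyer-23730)
AT EVERY CLASS NUMBER, from the four single-source print facts (Yan–Zhu Thm. 5.7 (1), BCS Prop. 4.2.2,
CGLS Thm. 5.1.3, Carayol), the transfer `h59g` (Yan–Zhu Thm. 5.9 (2) ⟹ (1) at `S ⊂ Λˣ`, read without
`p ∤ h_K`) and the route's by-name item `JSWAnticyclotomicControl` (JSW 2017 Thm. 3.3.1)** — §2 at `p = 3`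
fed to the landed σ-bridge `twoSidedLinkAnyClassNumberX10b_of_compositeValuation_of_thm331` (p606673).
Conditional on its six hypotheses; nothing else. [cite: YanZhu2024MainConjNonCM, Thm. 5.7 (1) and Thm. 5.9, §5.2]
[cite: BurungaleCastellaSkinner2025, Prop. 4.2.2] [cite: CastellaGrossiLeeSkinner2022, Thm. 5.1.3]
[cite: JetchevSkinnerWan2017, Thm. 3.3.1 and §7.4.1] [cite: Carayol1986] -/
theorem twoSidedLinkAnyClassNumberX10b_of_printFacts_of_transfer
    (h57 : thm57_isTorsion_charIdealXGr_eq_bdpLFunction)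
    (h59g : ∀ {p : ℕ} [Fact p.Prime] (ι' : PadicAlgCl p ≃+* ℂ) (W : WeierstrassCurve ℚ) [W.IsElliptic]
      [W.IsGloballyMinimal] (K : Type) [Field K] [NumberField K] (v vbar : HeightOneSpectrum (𝓞 K))
      (κ : ZpExtension K p) (γ : absoluteGaloisGroup K) [Fact (κ.IsTopGenerator γ)] {N : ℕ} [NeZero N]
      {f : CuspForm (CongruenceSubgroup.Gamma0 N) 2} (jbar : AlgebraicClosure K →+* ℂ)
      (_ : IsNewformOf W f),
      N = W.conductorNorm ℤ → 3 ≤ p → GoodOrd W p → (W.baseChange K).HasIrreducibleModPGaloisRep p →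
      IsImaginaryQuadratic K → SatisfiesHeegnerHypothesis N K →
        ((Ideal.span {(p : ℤ)}).primesOver (𝓞 K)).ncard = 2 →
        Odd (NumberField.discr K) → NumberField.discr K ≠ -3 → κ.IsAnticyclotomic →
      (∀ (w : InfinitePlace K) (k : 𝓞 K), k ∈ v.asIdeal ↔ ‖ι'.symm (w.embedding (k : K))‖ < 1) →
        ((p : ℕ) : 𝓞 K) ∈ vbar.asIdeal → vbar ≠ v →
      ∃ (ΩK : ℂ) (Ωp : (unrIntegers p)ˣ) (L : UnrSeries p),
        ΩK ≠ 0 ∧ IsBDPLFunction ι' v κ γ f ΩK ((Ωp : unrIntegers p) : ℂ_[p]) L ∧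
        ∀ (D : (W.baseChange K).LambdaAdicSelmerData κ γ) (F : HeegnerFamily N W K κ jbar)
          (X : (W.baseChange K).SelmerDualData κ γ) (j : ℤ_[p] →+* unrIntegers p),
          (∀ x : ℤ_[p], ((j x : unrIntegers p) : ℂ_[p]) = algebraMap ℚ_[p] ℂ_[p] (x : ℚ_[p])) →
          heegnerCharIdeal D F ^ 2 ≤
              Module.charIdeal (IwasawaAlgebra p) (Submodule.torsion (IwasawaAlgebra p) X.X) →
            L ∈ (AcSelmer.XAc.charIdeal (W.baseChange K) p κ vbar ∅ γ).map (PowerSeries.map j))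
    (h422 : BurungaleCastellaSkinner2025.prop422_exists_isBDPLFunction_mu_eq_zero)
    (h513 : thm513_exists_isBDPLFunction_valueAtOne_disc)
    (hC : ∀ (N : ℕ) [NeZero N], IsNewformOf.level_eq_conductorNorm (N := N))
    (h331 : Summit.BirchSwinnertonDyer.BirchSwinnertonDyer.Theses.PrintX10b.JSWAnticyclotomicControl) :
    Summit.BirchSwinnertonDyer.BirchSwinnertonDyer.Theses.PrintX10b.TwoSidedLinkAnyClassNumberX10b :=
  twoSidedLinkAnyClassNumberX10b_of_compositeValuation_of_thm331
    (compositeValuationThree_of_printFacts_of_transfer h57 h59g h422 h513 hC) h331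

/-- **The same with Carayol supplied by the modularity parametrisation fact** (`nonempty_modularParametrizationData`,
BCDT 2001; `IsNewformOf.level_eq_conductorNorm` is then a tree theorem by multiplicity one), so the
hypotheses are five named print facts + the transfer. [cite: YanZhu2024MainConjNonCM, Thm. 5.7 (1) and Thm. 5.9]
[cite: BCDTJAMS2001, Thm. A] [cite: Carayol1986] [cite: JetchevSkinnerWan2017, Thm. 3.3.1] -/
theorem twoSidedLinkAnyClassNumberX10b_of_printFacts_of_transfer_of_modularity
    (h57 : thm57_isTorsion_charIdealXGr_eq_bdpLFunction)
    (h59g : ∀ {p : ℕ} [Fact p.Prime] (ι' : PadicAlgCl p ≃+* ℂ) (W : WeierstrassCurve ℚ) [W.IsElliptic]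
      [W.IsGloballyMinimal] (K : Type) [Field K] [NumberField K] (v vbar : HeightOneSpectrum (𝓞 K))
      (κ : ZpExtension K p) (γ : absoluteGaloisGroup K) [Fact (κ.IsTopGenerator γ)] {N : ℕ} [NeZero N]
      {f : CuspForm (CongruenceSubgroup.Gamma0 N) 2} (jbar : AlgebraicClosure K →+* ℂ)
      (_ : IsNewformOf W f),
      N = W.conductorNorm ℤ → 3 ≤ p → GoodOrd W p → (W.baseChange K).HasIrreducibleModPGaloisRep p →
      IsImaginaryQuadratic K → SatisfiesHeegnerHypothesis N K →
        ((Ideal.span {(p : ℤ)}).primesOver (𝓞 K)).ncard = 2 →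
        Odd (NumberField.discr K) → NumberField.discr K ≠ -3 → κ.IsAnticyclotomic →
      (∀ (w : InfinitePlace K) (k : 𝓞 K), k ∈ v.asIdeal ↔ ‖ι'.symm (w.embedding (k : K))‖ < 1) →
        ((p : ℕ) : 𝓞 K) ∈ vbar.asIdeal → vbar ≠ v →
      ∃ (ΩK : ℂ) (Ωp : (unrIntegers p)ˣ) (L : UnrSeries p),
        ΩK ≠ 0 ∧ IsBDPLFunction ι' v κ γ f ΩK ((Ωp : unrIntegers p) : ℂ_[p]) L ∧
        ∀ (D : (W.baseChange K).LambdaAdicSelmerData κ γ) (F : HeegnerFamily N W K κ jbar)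
          (X : (W.baseChange K).SelmerDualData κ γ) (j : ℤ_[p] →+* unrIntegers p),
          (∀ x : ℤ_[p], ((j x : unrIntegers p) : ℂ_[p]) = algebraMap ℚ_[p] ℂ_[p] (x : ℚ_[p])) →
          heegnerCharIdeal D F ^ 2 ≤
              Module.charIdeal (IwasawaAlgebra p) (Submodule.torsion (IwasawaAlgebra p) X.X) →
            L ∈ (AcSelmer.XAc.charIdeal (W.baseChange K) p κ vbar ∅ γ).map (PowerSeries.map j))
    (h422 : BurungaleCastellaSkinner2025.prop422_exists_isBDPLFunction_mu_eq_zero)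
    (h513 : thm513_exists_isBDPLFunction_valueAtOne_disc)
    (hpar : nonempty_modularParametrizationData)
    (h331 : Summit.BirchSwinnertonDyer.BirchSwinnertonDyer.Theses.PrintX10b.JSWAnticyclotomicControl) :
    Summit.BirchSwinnertonDyer.BirchSwinnertonDyer.Theses.PrintX10b.TwoSidedLinkAnyClassNumberX10b :=
  twoSidedLinkAnyClassNumberX10b_of_printFacts_of_transfer h57 h59g h422 h513
    (fun _ _ ↦ IsNewformOf.level_eq_conductorNorm_of_exists_isNewformOf'
      (exists_isNewformOf_of_nonempty_modularParametrizationData hpar)) h331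

/-- **The general-`p` form: the TWO-SIDED link `X11b.IMCWaldspurgerOnTreeGoodAt p κ (inducedPlace ι) γ ι P`
at a good ordinary `p ≥ 3`, (irr_K), rank one, `Ш[p^∞]` finite, granted Howard's containment, AT EVERY
CLASS NUMBER** — the landed `X11b.imcWaldspurgerOnTreeGoodAt_inducedPlace_of_heegnerContainment_of_thm331`
(p4 g3, `PrintX9HowardIMCLink` §1) with its binder `¬ p ∣ h_K` deleted and `hYZ` replaced by the four
single-source facts + the transfer `h59g`; the σ-bridge verbatim. (It is the X9 twin B = stmt-23162 /
PrintX9's `TwoSidedLinkOfPrint` regime `p ∣ h_K` letter for letter as well; recorded here once.)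
[cite: YanZhu2024MainConjNonCM, Thm. 5.7 (1) and Thm. 5.9] [cite: BurungaleCastellaSkinner2025, Prop. 4.2.2]
[cite: CastellaGrossiLeeSkinner2022, Thm. 5.1.3] [cite: JetchevSkinnerWan2017, Thm. 3.3.1, §2.3.2]
[cite: Castella2018, Thm. 2.3, §5 (eq:IMC+BDP)] -/
theorem imcWaldspurgerOnTreeGoodAt_inducedPlace_of_printFacts_of_transfer
    (h57 : thm57_isTorsion_charIdealXGr_eq_bdpLFunction)
    (h59g : ∀ {p : ℕ} [Fact p.Prime] (ι' : PadicAlgCl p ≃+* ℂ) (W : WeierstrassCurve ℚ) [W.IsElliptic]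
      [W.IsGloballyMinimal] (K : Type) [Field K] [NumberField K] (v vbar : HeightOneSpectrum (𝓞 K))
      (κ : ZpExtension K p) (γ : absoluteGaloisGroup K) [Fact (κ.IsTopGenerator γ)] {N : ℕ} [NeZero N]
      {f : CuspForm (CongruenceSubgroup.Gamma0 N) 2} (jbar : AlgebraicClosure K →+* ℂ)
      (_ : IsNewformOf W f),
      N = W.conductorNorm ℤ → 3 ≤ p → GoodOrd W p → (W.baseChange K).HasIrreducibleModPGaloisRep p →
      IsImaginaryQuadratic K → SatisfiesHeegnerHypothesis N K →
        ((Ideal.span {(p : ℤ)}).primesOver (𝓞 K)).ncard = 2 →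
        Odd (NumberField.discr K) → NumberField.discr K ≠ -3 → κ.IsAnticyclotomic →
      (∀ (w : InfinitePlace K) (k : 𝓞 K), k ∈ v.asIdeal ↔ ‖ι'.symm (w.embedding (k : K))‖ < 1) →
        ((p : ℕ) : 𝓞 K) ∈ vbar.asIdeal → vbar ≠ v →
      ∃ (ΩK : ℂ) (Ωp : (unrIntegers p)ˣ) (L : UnrSeries p),
        ΩK ≠ 0 ∧ IsBDPLFunction ι' v κ γ f ΩK ((Ωp : unrIntegers p) : ℂ_[p]) L ∧
        ∀ (D : (W.baseChange K).LambdaAdicSelmerData κ γ) (F : HeegnerFamily N W K κ jbar)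
          (X : (W.baseChange K).SelmerDualData κ γ) (j : ℤ_[p] →+* unrIntegers p),
          (∀ x : ℤ_[p], ((j x : unrIntegers p) : ℂ_[p]) = algebraMap ℚ_[p] ℂ_[p] (x : ℚ_[p])) →
          heegnerCharIdeal D F ^ 2 ≤
              Module.charIdeal (IwasawaAlgebra p) (Submodule.torsion (IwasawaAlgebra p) X.X) →
            L ∈ (AcSelmer.XAc.charIdeal (W.baseChange K) p κ vbar ∅ γ).map (PowerSeries.map j))
    (h422 : BurungaleCastellaSkinner2025.prop422_exists_isBDPLFunction_mu_eq_zero)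
    (h513 : thm513_exists_isBDPLFunction_valueAtOne_disc)
    (hC : ∀ (N : ℕ) [NeZero N], IsNewformOf.level_eq_conductorNorm (N := N))
    (h331 : thm331_anticyclotomicControl)
    {W : WeierstrassCurve ℚ} [W.IsElliptic] [W.IsGloballyMinimal] {p : ℕ} [Fact p.Prime]
    {K : Type} [Field K] [NumberField K]
    (hp : 3 ≤ p) (hord : GoodOrd W p)
    (hK : IsImaginaryQuadratic K) (hodd : Odd (NumberField.discr K)) (h3 : NumberField.discr K ≠ -3)
    {N : ℕ} [NeZero N] (hN : W.conductorNorm ℤ = N) (hHN : SatisfiesHeegnerHypothesis N K)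
    (hHp : SatisfiesHeegnerHypothesis p K) (hirrK : (W.baseChange K).HasIrreducibleModPGaloisRep p)
    (ι : K →+* ℚ_[p]) (κ : ZpExtension K p) (hκ : κ.IsAnticyclotomic)
    (γ : Field.absoluteGaloisGroup K) [Fact (κ.IsTopGenerator γ)]
    (Dt : ModularParametrizationData W N) (hc : ¬ (p : ℤ) ∣ Dt.c)
    (H : HeegnerDatum N (NumberField.discr K)) (ιC : K →+* ℂ) (P : (W.baseChange K).toAffine.Point)
    (hP : WeierstrassCurve.Affine.Point.map ιC.toRatAlgHom P = heegnerPointComplex Dt H)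
    (hrk : (W.baseChange K).mordellWeilRank = 1)
    (hfinp : Finite (AddCommGroup.primaryComponent (W.baseChange K).sha p))
    (hPinf : ¬ IsOfFinAddOrder P)
    (hHow : ∃ (jbar : AlgebraicClosure K →+* ℂ) (D : (W.baseChange K).LambdaAdicSelmerData κ γ)
      (F : HeegnerFamily N W K κ jbar) (X : (W.baseChange K).SelmerDualData κ γ),
      heegnerCharIdeal D F ^ 2 ≤
        Module.charIdeal (IwasawaAlgebra p) (Submodule.torsion (IwasawaAlgebra p) X.X)) :
    X11b.IMCWaldspurgerOnTreeGoodAt p κ (X11b.inducedPlace ι) γ ι P := by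
  have hHN' : SatisfiesHeegnerHypothesis (W.conductorNorm ℤ) K := by rw [hN]; exact hHN
  -- the other prime `w` above `p`, of degree one, and THE embedding at it
  obtain ⟨w, hw, hwne⟩ := X11b.exists_other_prime hHp (X11b.inducedPlace ι)
    (X11b.natCast_mem_inducedPlace ι)
  have hsplit : X11b.SplitsIn K p := hHp p Fact.out (dvd_refl p)
  obtain ⟨he, hf⟩ := X11b.degreeOne_of_splitsIn hK.1 hsplit hw
  set ιw : K →+* ℚ_[p] := X11b.embAt K p w hw he hf with hιw
  -- a generator with non-zero constant term of the module strict at `v = inducedPlace ι`, from JSW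
  obtain ⟨-, F, hF, hF0, -⟩ := h331 W p hp hord.1 K hK hHp hHN' hirrK ι (X11b.inducedPlace ι)
    (X11b.mem_inducedPlace_iff ι) κ hκ γ hrk hfinp P hPinf
  -- the class-number-free composite at the embedding `ιw` (inducing `w`), strict prime `inducedPlace ι`
  obtain ⟨n, hn, hval⟩ := compositeValuation_of_printFacts_of_transfer h57 h59g h422 h513 hC W p hp
    hord K hK hHN' hHp hodd h3 hirrK ιw w (X11b.inducedPlace ι)
    (X11b.mem_asIdeal_iff_norm_embAt_lt_one w hw he hf) (X11b.natCast_mem_inducedPlace ι)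
    (fun h ↦ hwne h.symm) κ hκ γ N Dt H ιC P hP hHow F hF hF0
  -- `ιw = ι ∘ σ` for an involution `σ`; the log valuations agree in rank one
  obtain ⟨σ, hσ, hισ⟩ := X11b.exists_involutive_comp_eq hK.1 ι ιw
  have hlog : Literature.NumberTheory.EllipticCurves.padicLogOrd W p ιw P = X11b.padicLogOrd W p ι P := by
    rw [← hισ, ← X11b.padicLogOrd_eq_literature]
    exact padicLogOrd_comp_eq_of_rank_one W p (by omega) σ hσ ι hrk P hPinf
  have hc0 : padicValInt p Dt.c = 0 := padicValInt.eq_zero_of_not_dvd hc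
  refine ⟨n, (X11b.AcSelmer.hasCharValuationAt_iff_literature _ p κ (X11b.inducedPlace ι) ∅ γ n).mpr hn,
    ?_⟩
  rw [hlog] at hval
  omega

end Crux

end Summit.BirchSwinnertonDyer.BirchSwinnertonDyer.Cruxes.TwoSidedLinkAnyClassNumberX10b.CompositeTransferX10b

end
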